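import Summits.HodgeConjecture.HodgeConjecture.Theorems.HeckePrymWeilHeckePrymAnchorsPointClassWeights
import Summits.HodgeConjecture.HodgeConjecture.Theorems.HeckePrymWeilHeckePrymAnchorsIsogenyTransfer
import Literature.AlgebraicGeometry.HodgeTheory.TopDegreeClasses
import Literature.AlgebraicGeometry.HodgeTheory.HodgeConjectureQbarVoisinProofs
import Mathlib.LinearAlgebra.Dual.Lemmas
import HarnessLib

/-!
# Crux `HeckePrymAnchors` (stmt-HodgeConjecture-14496), line `Sketch` · stub A1 `stub_pointClassAnchor`

Route `HeckePrymWeil`. **Deligne's split anchor** (LNM 900, Lemma 4.5 / Remark 4.10, used for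
ALGEBRAICITY): for a complex abelian variety `A₀` of dimension `k₀` and a prime `p`, the strong Weil
plane `weilClassesOf (A₀ × A₀) ψ k₀ p ⊆ H^{2k₀}((A₀ × A₀)(ℂ); ℂ)` of the companion endomorphism
`ψ(x, y) = (-p y, x)` (`ψ² = -p`) consists of ALGEBRAIC classes.

On paper the plane is the line `⋀^{2k₀}(H¹(A₀) ⊗ e₊)` (plus its conjugate) and lies in the span of the
pull-backs of the point class of `A₀` along the homomorphisms `u·pr₁ + v·pr₂` (Vandermonde). The
tree has no `H•(A(ℂ)) = ⋀• H¹` on the real carriers, so the proof below replaces the exterior-algebra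
dictionary by an OPERATOR argument using only the proved polynomiality of pull-backs
(`pca_poly₂_map_add`, from Künneth spanning; sibling file `…PointClassWeights`):

* for `c` in a Weil eigen-line, `q(u, w) := ℓ((𝟙 + u·ψ + w·h)^* c)` (`h = -e₂₂ = -(0, pr₂)`, `ℓ` a
  linear form killing the algebraic classes) is a polynomial function on `ℕ × ℕ`;
* on the line `w = 0` the eigen-condition gives `q(y, 0) = (1 + y θ)^{2k₀} ℓ(c)`, `θ = ± i√p`;
* on the parabola `w = 1 + p u²` the endomorphism `𝟙 + u·ψ + (1 + p u²)·h = (pr₁ - p u·pr₂) ≫ (𝟙, u·𝟙)`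
  FACTORS THROUGH `A₀` (`pca_rankOne_eq`), so `(…)^* c` is the flat pull-back of a top-degree —
  hence algebraic (`mem_algebraicClasses_of_degree_top`) — class of `A₀`, and `q = 0` there
  (`pca_map_rankOne_mem`, `map_mem_algebraicClasses_of_flat`);
* the two polynomial identities meet at the complex point `u = θ⁻¹` (where `1 + p u² = 0`: the
  rank-one projector `𝟙 + θ⁻¹ψ`), forcing `2^{2k₀} ℓ(c) = 0` (`pca_endgame`), i.e. `ℓ(c) = 0` for every
  such `ℓ`: `c` is algebraic.

Degree `k₀ = 0` is the tree's `algebraicClasses_zero`. The hypotheses `p % 4 = 3`, `7 ≤ p` of the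
registered signature are not used (only `p ≠ 0`).
-/

noncomputable section
-- every declaration of this problem lives in Summit.HodgeConjecture.HodgeConjecture.… (summit = sub-problem)
set_option linter.dupNamespace false

open CategoryTheory AlgebraicGeometry
open Literature.AlgebraicGeometry

namespace Summit.HodgeConjecture.HodgeConjecture.Theorems.HeckePrymWeilLine

open Literature.AlgebraicGeometry.Motives Literature.AlgebraicGeometry.HodgeTheory
open Literature.AlgebraicTopology.SingularHomology

/-! ## The rank-one endomorphisms in the pencil `𝟙 + u·ψ + w·h` -/

/-- **The parabola of rank-one endomorphisms**: with `ψ = (-p·pr₂, pr₁)` and `h = -(0, pr₂)`,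
`𝟙 + n·ψ + (1 + p n²)·h = (pr₁ - p n·pr₂) ≫ (𝟙, n·𝟙)` factors through `A₀`
(`(P, Q) ↦ (R, nR)`, `R = P - p n Q`). [cite: Deligne1982HodgeCycles, §4 Lemma 4.5 and Remark 4.10] -/
theorem pca_rankOne_eq (A₀ : AbelianVariety ℂ) (p n : ℕ) :
    𝟙 (A₀.prod A₀) +
        n • AbelianVariety.prodLift (AbelianVariety.snd A₀ A₀ ≫ (-((p : ℤ) • 𝟙 A₀)))
          (AbelianVariety.fst A₀ A₀) +
        (1 + p * n ^ 2) • (-(AbelianVariety.prodLift (0 : A₀.prod A₀ ⟶ A₀) (AbelianVariety.snd A₀ A₀))) =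
      (AbelianVariety.fst A₀ A₀ + (-((p * n : ℕ) : ℤ)) • AbelianVariety.snd A₀ A₀) ≫
        AbelianVariety.prodLift (𝟙 A₀) (n • 𝟙 A₀) := by
  apply AbelianVariety.prod_hom_ext
  · simp only [Preadditive.add_comp, Preadditive.nsmul_comp, Preadditive.neg_comp, Category.id_comp,
      Category.assoc, AbelianVariety.prodLift_fst, Preadditive.comp_neg, Preadditive.comp_zsmul,
      Category.comp_id, neg_zero, smul_zero, add_zero]
    module
  · simp only [Preadditive.add_comp, Preadditive.nsmul_comp, Preadditive.neg_comp, Category.id_comp,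
      Category.assoc, AbelianVariety.prodLift_snd, Preadditive.comp_nsmul, Category.comp_id]
    module

/-- **Pull-back along an endomorphism factoring through `A₀` via `pr₁ + m·pr₂` lands in the
algebraic classes** (degree `2k₀ = 2 dim A₀`): `g^* c` is a top-degree class of `A₀`, hence
algebraic, and `pr₁ + m·pr₂ = α ≫ pr₁` with `α = (pr₁ + m·pr₂, pr₂)` an automorphism is flat, so
flat pull-back applies. [cite: Deligne1982HodgeCycles, §4 Lemma 4.5] [cite: Hartshorne1977, III Prop. 9.2 (b)] -/
theorem pca_map_rankOne_mem {k₀ : ℕ} (hk : 1 ≤ k₀) (A₀ : AbelianVariety ℂ) (hA₀ : A₀.dim = k₀)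
    (m : ℤ) (g : A₀ ⟶ A₀.prod A₀) (c : complexBetti (A₀.prod A₀).X (2 * k₀)) :
    complexBetti.map ((AbelianVariety.fst A₀ A₀ + m • AbelianVariety.snd A₀ A₀) ≫ g).hom.hom.hom
        (2 * k₀) c ∈ algebraicClasses (A₀.prod A₀).X k₀ := by
  set π : A₀.prod A₀ ⟶ A₀ := AbelianVariety.fst A₀ A₀ + m • AbelianVariety.snd A₀ A₀ with hπdef
  -- `g^* c` is a top-degree class on `A₀`, hence algebraic
  have hA : IsSmoothProjective k₀ A₀.X := by
    have h := (AbelianVariety.isSmoothProjective_holds (A := A₀))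
    rwa [AbelianVariety.isSmoothProjective, hA₀] at h
  have hg : complexBetti.map g.hom.hom.hom (2 * k₀) c ∈ algebraicClasses A₀.X k₀ :=
    mem_algebraicClasses_of_degree_top hA hk _
  -- `π = α ≫ pr₁` with `α` an automorphism
  let α : A₀.prod A₀ ⟶ A₀.prod A₀ := AbelianVariety.prodLift π (AbelianVariety.snd A₀ A₀)
  let β : A₀.prod A₀ ⟶ A₀.prod A₀ :=
    AbelianVariety.prodLift (AbelianVariety.fst A₀ A₀ + (-m) • AbelianVariety.snd A₀ A₀)
      (AbelianVariety.snd A₀ A₀)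
  have hαβ : α ≫ β = 𝟙 _ := by
    apply AbelianVariety.prod_hom_ext
    · rw [Category.assoc, AbelianVariety.prodLift_fst, Preadditive.comp_add, Preadditive.comp_zsmul,
        AbelianVariety.prodLift_fst, AbelianVariety.prodLift_snd, Category.id_comp, hπdef]
      module
    · rw [Category.assoc, AbelianVariety.prodLift_snd, AbelianVariety.prodLift_snd, Category.id_comp]
  have hβα : β ≫ α = 𝟙 _ := by
    apply AbelianVariety.prod_hom_ext
    · rw [Category.assoc, AbelianVariety.prodLift_fst, hπdef, Preadditive.comp_add,
        Preadditive.comp_zsmul, AbelianVariety.prodLift_fst, AbelianVariety.prodLift_snd,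
        Category.id_comp]
      module
    · rw [Category.assoc, AbelianVariety.prodLift_snd, AbelianVariety.prodLift_snd, Category.id_comp]
  have hπ : π = α ≫ AbelianVariety.fst A₀ A₀ := (AbelianVariety.prodLift_fst _ _).symm
  haveI : IsIso α.hom.hom.hom.left :=
    ⟨⟨β.hom.hom.hom.left,
      by change (α ≫ β).hom.hom.hom.left = _; rw [hαβ]; rfl,
      by change (β ≫ α).hom.hom.hom.left = _; rw [hβα]; rfl⟩⟩
  haveI : Flat (AbelianVariety.fst A₀ A₀).hom.hom.hom.left := by
    change Flat (Limits.pullback.fst A₀.X.hom A₀.X.hom)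
    haveI : Subsingleton ↥(Spec (CommRingCat.of ℂ)) :=
      inferInstanceAs (Subsingleton (PrimeSpectrum ℂ))
    exact MorphismProperty.pullback_fst _ _ inferInstance
  haveI : Flat π.hom.hom.hom.left := by
    rw [hπ]
    change Flat (α.hom.hom.hom.left ≫ (AbelianVariety.fst A₀ A₀).hom.hom.hom.left)
    infer_instance
  haveI := isLocallyNoetherian_abelianVariety_left (A₀.prod A₀)
  haveI := isLocallyNoetherian_abelianVariety_left A₀
  have hcomp : complexBetti.map (π ≫ g).hom.hom.hom (2 * k₀) c =
      complexBetti.map π.hom.hom.hom (2 * k₀) (complexBetti.map g.hom.hom.hom (2 * k₀) c) := by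
    change complexBetti.map (π.hom.hom.hom ≫ g.hom.hom.hom) _ c = _
    rw [complexBetti.map_comp]
    rfl
  rw [hcomp]
  exact map_mem_algebraicClasses_of_flat π.hom.hom.hom hg

/-! ## Eigenclasses of the pencil are algebraic -/

/-- **The operator form of Deligne's Lemma 4.5.** Let `dim A₀ = k₀ ≥ 1`, `θ² = -p ≠ 0`, and let
`c ∈ H^{2k₀}((A₀ × A₀)(ℂ); ℂ)` satisfy `(𝟙 + y·ψ)^* c = (1 + yθ)^{2k₀} c` for all `y : ℕ`. Then `c` is
algebraic: otherwise a linear form `ℓ` with `ℓ(c) = 1` killing the algebraic classes makes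
`q(u, w) = ℓ((𝟙 + u·ψ + w·h)^* c)` a polynomial function with `q(y, 0) = (1 + yθ)^{2k₀}` and
`q(a, 1 + p a²) = 0` (rank-one parabola), contradicting `pca_endgame`.
[cite: Deligne1982HodgeCycles, §4 Lemma 4.5 and Remark 4.10] -/
theorem pca_mem_algebraicClasses_of_eigen {p : ℕ} (hp : p ≠ 0) {k₀ : ℕ} (hk : 1 ≤ k₀)
    (A₀ : AbelianVariety ℂ) (hA₀ : A₀.dim = k₀) {θ : ℂ} (hθ : θ ^ 2 = -(p : ℂ))
    (c : complexBetti (A₀.prod A₀).X (2 * k₀))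
    (hc : ∀ y : ℕ, complexBetti.map ((1 : ℕ) • 𝟙 (A₀.prod A₀) +
        y • AbelianVariety.prodLift (AbelianVariety.snd A₀ A₀ ≫ (-((p : ℤ) • 𝟙 A₀)))
          (AbelianVariety.fst A₀ A₀)).hom.hom.hom (2 * k₀) c = ((1 + (y : ℂ) * θ) ^ (2 * k₀)) • c) :
    c ∈ algebraicClasses (A₀.prod A₀).X k₀ := by
  set ψ : A₀.prod A₀ ⟶ A₀.prod A₀ := AbelianVariety.prodLift
    (AbelianVariety.snd A₀ A₀ ≫ (-((p : ℤ) • 𝟙 A₀))) (AbelianVariety.fst A₀ A₀) with hψ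
  set h : A₀.prod A₀ ⟶ A₀.prod A₀ :=
    -(AbelianVariety.prodLift (0 : A₀.prod A₀ ⟶ A₀) (AbelianVariety.snd A₀ A₀)) with hh
  by_contra hc'
  obtain ⟨ℓ, hℓc, hℓ⟩ := Submodule.exists_dual_map_eq_bot_of_notMem hc' inferInstance
  have hker : ∀ x ∈ algebraicClasses (A₀.prod A₀).X k₀, ℓ x = 0 := fun x hx ↦ by
    rw [← LinearMap.mem_ker]
    exact LinearMap.le_ker_iff_map.mpr hℓ hx
  -- the polynomial function `q`
  obtain ⟨r, hr⟩ := pca_poly₂_map ((ℓ c)⁻¹ • ℓ) (pca_poly₂_map_add (𝟙 (A₀.prod A₀)) ψ h (2 * k₀) c)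
  refine pca_endgame hp hθ (2 * k₀)
    (fun u w ↦ ((ℓ c)⁻¹ • ℓ)
      (complexBetti.map (𝟙 (A₀.prod A₀) + u • ψ + w • h).hom.hom.hom (2 * k₀) c))
    ⟨r, hr⟩ (fun y ↦ ?_) (fun a ↦ ?_)
  · -- the eigen-line `w = 0`
    have e0 : 𝟙 (A₀.prod A₀) + y • ψ + (0 : ℕ) • h = (1 : ℕ) • 𝟙 (A₀.prod A₀) + y • ψ := by
      rw [zero_smul, add_zero, one_smul]
    dsimp only
    rw [e0, hc y, map_smul, LinearMap.smul_apply, smul_eq_mul, smul_eq_mul, inv_mul_cancel₀ hℓc,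
      mul_one]
  · -- the rank-one parabola `w = 1 + p a²`
    dsimp only
    rw [pca_rankOne_eq A₀ p a, LinearMap.smul_apply, hker _ (pca_map_rankOne_mem hk A₀ hA₀ _ _ c),
      smul_zero]

/-- `(i√p)² = -p`. [folklore] -/
theorem pca_I_mul_sqrt_sq (p : ℕ) : (Complex.I * (Real.sqrt (p : ℝ) : ℂ)) ^ 2 = -(p : ℂ) := by
  rw [mul_pow, Complex.I_sq, ← Complex.ofReal_pow, Real.sq_sqrt (Nat.cast_nonneg _)]
  push_cast
  ring

/-! ## The stub -/

/-- **Stub A1 — Deligne's split anchor in typed form** (LNM 900 Lemma 4.5 / Remark 4.10 used for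
ALGEBRAICITY): the strong Weil plane of `(A₀ × A₀, companion)` in degree `2k₀ = 2 dim A₀` consists
of algebraic classes. Both eigen-lines `E₊` (`θ = i√p`) and `E₋` (`θ = -i√p`) are handled by
`pca_mem_algebraicClasses_of_eigen` (the eigen-condition at `x = 1`); `k₀ = 0` is
`algebraicClasses_zero`. [cite: Deligne1982HodgeCycles, §4 Lemma 4.5 and Remark 4.10] -/
theorem stub_pointClassAnchor :
    ∀ p : ℕ, p.Prime → p % 4 = 3 → 7 ≤ p → ∀ (k₀ : ℕ) (A₀ : AbelianVariety ℂ), A₀.dim = k₀ →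
      weilClassesOf (A₀.prod A₀)
          (AbelianVariety.prodLift (AbelianVariety.snd A₀ A₀ ≫ (-((p : ℤ) • 𝟙 A₀)))
            (AbelianVariety.fst A₀ A₀)) k₀ p ≤
        algebraicClasses (A₀.prod A₀).X k₀ := by
  intro p hp _ _ k₀ A₀ hA₀
  rcases Nat.eq_zero_or_pos k₀ with rfl | hk
  · rw [algebraicClasses_zero]
    exact le_top
  have hp0 : p ≠ 0 := hp.ne_zero
  refine sup_le (fun c hc ↦ ?_) (fun c hc ↦ ?_)
  · refine pca_mem_algebraicClasses_of_eigen hp0 hk A₀ hA₀ (pca_I_mul_sqrt_sq p) c fun y ↦ ?_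
    have e := (mem_weilClassesPlus_iff.mp hc) 1 y
    rw [Nat.cast_one] at e
    rw [show (1 + (y : ℂ) * (Complex.I * (Real.sqrt (p : ℝ) : ℂ))) =
      1 + (y : ℂ) * Complex.I * (Real.sqrt (p : ℝ) : ℂ) by ring]
    exact e
  · refine pca_mem_algebraicClasses_of_eigen hp0 hk A₀ hA₀ (θ := -(Complex.I * (Real.sqrt (p : ℝ) : ℂ)))
      (by rw [neg_sq, pca_I_mul_sqrt_sq]) c fun y ↦ ?_
    have e := (mem_weilClassesMinus_iff.mp hc) 1 y
    rw [Nat.cast_one] at e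
    rw [show (1 + (y : ℂ) * -(Complex.I * (Real.sqrt (p : ℝ) : ℂ))) =
      1 - (y : ℂ) * Complex.I * (Real.sqrt (p : ℝ) : ℂ) by ring]
    exact e

end Summit.HodgeConjecture.HodgeConjecture.Theorems.HeckePrymWeilLine

end
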